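import Mathlib

/-!
# Admissible monodromy classes for prism-manifold fibres (PART I-ter `paper/prism-fibres.md` §4.5)

Solo residency `solo-SmoothPoincare4-informed`, session 117 (CLAIMS C787, C810). THEOREM 4.5 of the
residency's Part I-ter says that for odd `d` all fibred 2-knots in homotopy 4-spheres with closed
fibre the prism manifold `F_d = S³/(Q₈ × C_d)` have ONE exterior. Given the literature input
(`π₀Diff(F_d, ∗) ≅ S₄ × C₂` acting on `π₁ = Q₈ × C_d` through `Aut Q₈ × {±1}`, McCullough 2002 and
the Smale conjecture for quaternionic manifolds), the proof is finite group theory, certified here: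

* `H₁`-ADMISSIBILITY ON `Q₈^{ab} = C₂²`: an element `A ∈ GL(2, 𝔽₂)` has `A - 1` invertible iff `A` is
  one of the two elements of order `3` (`gl2_admissible_iff`, `order_three_elements`,
  `other_elements_order_le_two`) — in entries, by `decide` over `𝔽₂`.
* ON `C_d` (`d` odd): `u - 1` is a unit for `u = -1` and not for `u = 1` (`d > 1`)
  (`neg_one_admissible`, `one_not_admissible`).
* IN `S₄` (`= Aut Q₈`, acting on `Q₈^{ab}` through `S₄ → S₃ = GL(2,2)`): the elements of order `3`
  form ONE conjugacy class, closed under inversion (`isConj_of_orderOf_three`,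
  `orderOf_inv_eq_three`); hence in `S₄ × C₂` the admissible based classes `(order 3, -1)` form one
  conjugacy class closed under inversion (`admissible_classes_conj`, `admissible_classes_inv`) —
  which is '4.5: one exterior `E_d`, and the (sphere, knot) pairs with that exterior form a Gluck pair'.

Nothing topological is formalised; the dictionary `π₀Diff(F_d,∗) ≅ S₄ × C₂` is the cited literature.
-/

namespace Summit.SmoothPoincare4.SmoothPoincare4.Theorems
namespace PrismMonodromy

open Equiv

/-! ## `GL(2, 𝔽₂)` in entries -/

/-- For `A = !![a, b; c, d] ∈ GL(2, 𝔽₂)` (`ad - bc = 1`): `det (A - 1) = 1` iff `A` is one of the two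
matrices `!![0,1;1,1]`, `!![1,1;1,0]` (the elements of order `3` of `GL(2,2) ≅ S₃`). -/
theorem gl2_admissible_iff :
    ∀ a b c d : ZMod 2, a * d - b * c = 1 →
      ((a - 1) * (d - 1) - b * c = 1 ↔
        ((a = 0 ∧ b = 1 ∧ c = 1 ∧ d = 1) ∨ (a = 1 ∧ b = 1 ∧ c = 1 ∧ d = 0))) := by
  decide

/-- The two admissible matrices have order `3`: `A ≠ 1`, `A³ = 1`. -/
theorem order_three_elements :
    (!![0, 1; 1, 1] : Matrix (Fin 2) (Fin 2) (ZMod 2)) ≠ 1 ∧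
    (!![0, 1; 1, 1] : Matrix (Fin 2) (Fin 2) (ZMod 2)) ^ 3 = 1 ∧
    (!![1, 1; 1, 0] : Matrix (Fin 2) (Fin 2) (ZMod 2)) ≠ 1 ∧
    (!![1, 1; 1, 0] : Matrix (Fin 2) (Fin 2) (ZMod 2)) ^ 3 = 1 := by
  refine ⟨?_, ?_, ?_, ?_⟩
  · intro h
    have := congrFun (congrFun h 0) 0
    simp at this
  · ext i j
    fin_cases i <;> fin_cases j <;>
      simp [pow_succ, Matrix.mul_apply, Fin.sum_univ_two] <;> decide
  · intro h
    have := congrFun (congrFun h 0) 1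
    simp at this
  · ext i j
    fin_cases i <;> fin_cases j <;>
      simp [pow_succ, Matrix.mul_apply, Fin.sum_univ_two] <;> decide

/-- The NON-admissible elements of `GL(2, 𝔽₂)` (`det (A - 1) = 0`) satisfy `A² = 1` (they are the
identity and the three involutions), so 'admissible' = 'of order `3`'. In entries: `A² = 1` reads
`a² + bc = 1`, `b(a+d) = 0`, `c(a+d) = 0`, `d² + bc = 1`. -/
theorem other_elements_order_le_two :
    ∀ a b c d : ZMod 2, a * d - b * c = 1 → (a - 1) * (d - 1) - b * c = 0 →
        (a * a + b * c = 1 ∧ b * (a + d) = 0 ∧ c * (a + d) = 0 ∧ d * d + b * c = 1) := by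
  decide

/-! ## The cyclic factor `C_d`, `d` odd -/

/-- `u = -1` is admissible on `C_d` for odd `d`: `-1 - 1 = -2` is a unit of `ZMod d`. -/
theorem neg_one_admissible (d : ℕ) (hd : Odd d) : IsUnit ((-1 : ZMod d) - 1) := by
  have h2 : IsUnit ((2 : ℕ) : ZMod d) := by
    rw [ZMod.isUnit_iff_coprime]
    exact (Nat.Prime.coprime_iff_not_dvd Nat.prime_two).2
      (fun h => (Nat.not_even_iff_odd.2 hd) (even_iff_two_dvd.2 h))
  have : ((-1 : ZMod d) - 1) = -((2 : ℕ) : ZMod d) := by push_cast; ring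
  rw [this]
  exact h2.neg

/-- `u = 1` is not admissible on `C_d` for `d > 1`: `1 - 1 = 0` is not a unit. -/
theorem one_not_admissible (d : ℕ) (hd : 1 < d) : ¬ IsUnit ((1 : ZMod d) - 1) := by
  haveI : Fact (1 < d) := ⟨hd⟩
  simp

/-! ## `S₄`: the elements of order three form one conjugacy class, closed under inversion -/

/-- A permutation of `Fin 4` of order `3` is a `3`-cycle: its cycle type is `{3}`. -/
theorem cycleType_of_orderOf_three (σ : Perm (Fin 4)) (h : orderOf σ = 3) :
    σ.cycleType = {3} := by
  have hp : (orderOf σ).Prime := by rw [h]; norm_num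
  obtain ⟨n, hn⟩ := Equiv.Perm.cycleType_prime_order hp
  rw [h] at hn
  have hsum : σ.cycleType.sum ≤ 4 := by
    rw [Equiv.Perm.sum_cycleType]
    exact (Finset.card_le_univ _).trans (by simp)
  rw [hn, Multiset.sum_replicate, smul_eq_mul] at hsum
  have : n = 0 := by omega
  subst this
  simpa using hn

/-- Any two elements of order `3` of `S₄` are conjugate. -/
theorem isConj_of_orderOf_three (σ τ : Perm (Fin 4)) (hσ : orderOf σ = 3) (hτ : orderOf τ = 3) :
    IsConj σ τ := by
  rw [Equiv.Perm.isConj_iff_cycleType_eq, cycleType_of_orderOf_three σ hσ,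
    cycleType_of_orderOf_three τ hτ]

/-- The class is closed under inversion. -/
theorem orderOf_inv_eq_three (σ : Perm (Fin 4)) (hσ : orderOf σ = 3) : orderOf σ⁻¹ = 3 := by
  rw [orderOf_inv, hσ]

/-- There ARE elements of order `3` (e.g. the `3`-cycle `(0 1 2)`), so the class is non-empty. -/
theorem exists_orderOf_three : ∃ σ : Perm (Fin 4), orderOf σ = 3 := by
  refine ⟨swap 0 1 * swap 1 2, ?_⟩
  rw [orderOf_eq_iff (by norm_num)]
  refine ⟨by decide, fun m hm hm0 => ?_⟩
  interval_cases m <;> decide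

/-! ## `S₄ × C₂`: the admissible based classes `(order 3, -1)` -/

/-- In `S₄ × C₂` (`C₂` written multiplicatively as `ℤˣ = {1, -1}`), any two admissible based
monodromy classes `(σ, -1)`, `(τ, -1)` with `σ, τ` of order `3` are conjugate. -/
theorem admissible_classes_conj (σ τ : Perm (Fin 4)) (hσ : orderOf σ = 3) (hτ : orderOf τ = 3) :
    IsConj ((σ, -1) : Perm (Fin 4) × ℤˣ) (τ, -1) := by
  obtain ⟨c, hc⟩ := isConj_iff.1 (isConj_of_orderOf_three σ τ hσ hτ)
  exact isConj_iff.2 ⟨(c, 1), by ext <;> simp [hc]⟩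

/-- … and the set of admissible based classes is closed under inversion
(`(σ, -1)⁻¹ = (σ⁻¹, -1)` with `σ⁻¹` again of order `3`). -/
theorem admissible_classes_inv (σ : Perm (Fin 4)) (hσ : orderOf σ = 3) :
    ((σ, -1) : Perm (Fin 4) × ℤˣ)⁻¹ = (σ⁻¹, -1) ∧ orderOf σ⁻¹ = 3 := by
  refine ⟨by ext <;> simp, orderOf_inv_eq_three σ hσ⟩

end PrismMonodromy
end Summit.SmoothPoincare4.SmoothPoincare4.Theorems
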